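import Mathlib
import HarnessLib
import Literature.MathematicalPhysics.StatisticalMechanics.RenormalisationMapLipschitzQ

/-!
# `Σ₁` on single `(k+1)`-blocks with FREE extracted Hamiltonians: the `L^d` / `A·A^{−|U|_{k+1}}` form
# ([ABKM19] Theorem 6.8 (6.59)–(6.60), Lemma 9.6 — block sum)

`RenormalisationMapLipschitzQ.tayNormLE_remainderOne_sub_abkm_block_of_stepKernelBounds` converts the `Σ₁` Lipschitz bound to the
shape `L^d κ^{L^d}[…]·(A·A^{−|U|_{k+1}})` (the block sum is empty unless `U` is a single `(k+1)`-block, where `|U|_k = L^d` and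
`A·A^{−|U|_{k+1}} = 1`), but only for the extracted Hamiltonians `H̃ = nextH D H K`, `H̃' = nextH D H' K'` of ONE step datum.  The
two-kernel comparison of `S_k` (line `banach_two_kernel` of the child `TwoKernelSkBound` of the cruxes `HypACumulant` /
`HypALocalTwoPoint`, route `Summits/HubbardSuperconductivity/…/Theses/ComplexGFFStiffness`) uses the `Σ₁` bound with
`H̃ = nextH D_a H K`, `H̃' = nextH D_b H K` (two step data), i.e. with FREE `H̃, H̃'` of norm `≤ τ`:

* **`tayNormLE_remainderOne_sub_abkm_blockFree_of_stepKernelBounds`** — the bound of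
  `tayNormLE_remainderOne_sub_abkm_of_stepKernelBounds` (free `H̃, H̃'`) with `|U|_k ↦ L^d` and the factor `A·aFactor_{k+1}(U)`.

Everything is proved; no named fact.

## References
* S. Adams, S. Buchholz, R. Kotecký, S. Müller, arXiv:1910.13564, Theorem 6.8 ((6.59)–(6.60)), Lemma 9.6 (proof, first order)
  [AdamsBuchholzKoteckyMuller2019].
-/

noncomputable section

namespace Literature.MathematicalPhysics.StatisticalMechanics.GradientRG

open scoped BigOperators Classical
open Finset MeasureTheory
open Literature.MathematicalPhysics.StatisticalMechanics.TorusPolymer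
  (IsPolymer blocks polys bprod blockOf thicken reblock boxCorner mem_polys mem_blocks numBlocks isPolymer_blockOf
    card_blocks_eq_numBlocks blocks_blockOf empty_mem_polys closure mem_blockOf_self)
open Literature.Barriers.CriticalPhenomena.LongRangePhi4.Polymer (IsConn components)
open Literature.MathematicalPhysics.StatisticalMechanics.GradientFRD (iterDiff)
open Literature.MathematicalPhysics.QuantumFieldTheory

variable {d M : ℕ} [NeZero M]

set_option maxHeartbeats 400000 in
/-- **`Σ₁` on single `(k+1)`-blocks, free extracted Hamiltonians** (module docstring): the data of
`tayNormLE_remainderOne_sub_abkm_of_stepKernelBounds`; conclusion with `|U|_k` replaced by `L^d` and multiplied by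
`A·A^{−|U|_{k+1}}`. [cite: AdamsBuchholzKoteckyMuller2019, Theorem 6.8 / Lemma 9.6 (proof, first order)] -/
theorem tayNormLE_remainderOne_sub_abkm_blockFree_of_stepKernelBounds {L N Mord R n p r₀ : ℕ} {θbar lam μ δ₁ δ₀ A𝒫 A𝒫' C₂ h A : ℝ}
    {𝒞 : ℕ → (Fin d → ZMod M) → ℝ} (hd : 3 ≤ d) (hLodd : Odd L) (hL : 2 ^ (d + 3) + 16 * R ≤ L)
    (hR2 : 2 ≤ R) (hM : M = L ^ N) {k : ℕ} (hkN : k + 1 ≤ N) (hp : d / 2 + 1 ≤ p) (hpR : p ≤ R)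
    (hMord : d / 2 + 1 ≤ Mord) (hr₀ : 2 ≤ r₀)
    (hB : AbkmWeightBounds L N Mord R n θbar lam μ δ₁ δ₀ A𝒫 𝒞
      (abkmWeightData L N Mord R θbar (schedDelta δ₀ δ₁ N) 𝒞))
    (hδ₀ : 0 < δ₀) (hδ₁ : 0 < δ₁) (hh : 0 < h) (hh0 : hZeroSq d R δ₀ δ₁ ≤ h ^ 2)
   
    (hh2 : C₂ ≤ h ^ 2) (hA𝒫 : 0 ≤ A𝒫') (hA1 : 1 ≤ A)
    (D : StepData d M) (hDs : D.s = L ^ k) (hDL : D.L = L) (hS : StepKernelBounds (abkmWeightData L N Mord R θbar (schedDelta δ₀ δ₁ N) 𝒞) L k A𝒫' C₂ D.𝒞)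
    {x₀ : Fin d → ZMod M} (hB₀ : D.B₀ = blockOf (L ^ k) x₀) (hc₀ : D.c₀ = boxCorner (L ^ k) (starRad R L d k) x₀)
    {U : Finset (Fin d → ZMod M)} (hU : IsPolymer (L ^ (k + 1)) U)
    {Ht Ht' H H' : RelevantHamiltonian ℂ d} {τ b : ℝ}
    (hHt : hamNorm (fieldWt h (L : ℝ) d k) ((L : ℝ) ^ k) (L ^ (d * k)) Ht ≤ τ)
    (hHt' : hamNorm (fieldWt h (L : ℝ) d k) ((L : ℝ) ^ k) (L ^ (d * k)) Ht' ≤ τ) (hτ : τ ≤ 1 / 16)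
    (hH : hamNorm (fieldWt h (L : ℝ) d k) ((L : ℝ) ^ k) (L ^ (d * k)) H ≤ b)
    (hH' : hamNorm (fieldWt h (L : ℝ) d k) ((L : ℝ) ^ k) (L ^ (d * k)) H' ≤ b) (hb : b ≤ 1 / 64)
    {K K' : Finset (Fin d → ZMod M) → ((Fin d → ZMod M) → ℝ) → ℂ} {C CΔ : ℝ} (hC : 0 ≤ C) (hCΔ : 0 ≤ CΔ)
    (hK : WeakNormLE (abkmNormParams L N Mord R p r₀ h θbar A (schedDelta δ₀ δ₁ N) 𝒞) k K C)
    (hK' : WeakNormLE (abkmNormParams L N Mord R p r₀ h θbar A (schedDelta δ₀ δ₁ N) 𝒞) k K' C)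
    (hΔ : WeakNormLE (abkmNormParams L N Mord R p r₀ h θbar A (schedDelta δ₀ δ₁ N) 𝒞) k (K - K') CΔ)
    (hKd : ∀ Y, ContDiff ℝ r₀ (K Y)) (hK'd : ∀ Y, ContDiff ℝ r₀ (K' Y))
    (hKloc : ∀ Y, IsPolymer (L ^ k) Y → IsConn Y →
      IsGaugeLocal ((abkmNormParams L N Mord R p r₀ h θbar A (schedDelta δ₀ δ₁ N) 𝒞).gauge k Y) (K Y))
    (hK'loc : ∀ Y, IsPolymer (L ^ k) Y → IsConn Y →
      IsGaugeLocal ((abkmNormParams L N Mord R p r₀ h θbar A (schedDelta δ₀ δ₁ N) 𝒞).gauge k Y) (K' Y))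
    (hv : pi2BoundConst d (((2 * R + 2 : ℕ) : ℝ) + ((d / 2 + 1 : ℕ) : ℝ)) * (C * A𝒫' * A⁻¹) ≤ 1 / 64)
    {κ : ℝ}
    (hκ : 1 + Real.exp (1 / 4) +
      16 * Real.exp (3 / 8) * hamNorm (fieldWt h (L : ℝ) d k) ((L : ℝ) ^ k) (L ^ (d * k)) (Ht - Ht') ≤ κ)
    (hκ' : 1 + Real.exp (1 / 4) + 16 * Real.exp (3 / 8) * τ ≤ κ) :
    TayNormLE ((abkmNormParams L N Mord R p r₀ h θbar A (schedDelta δ₀ δ₁ N) 𝒞).gauge (k + 1) U) r₀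
      ((abkmWeightData L N Mord R θbar (schedDelta δ₀ δ₁ N) 𝒞).weight (k + 1) U)
      (fun φ => (∑ B ∈ blockPartIndex D U,
        ((bprod (L ^ k) (fun B' => expNegH Ht B' φ) (U \ B) *
              bprod (L ^ k) (fun B' => expNegH (-Ht) B' φ) (B \ U) - 1) * blockTerm D K B φ +
          bprod (L ^ k) (fun B' => expNegH Ht B' φ) (U \ B) *
              bprod (L ^ k) (fun B' => expNegH (-Ht) B' φ) (B \ U) *
            (fluctDefect D.𝒞 H B φ +
              (expNegH (stepOpA (gradCov D.𝒞) H) B φ - 1) * (1 - Complex.exp (-(eval (opB D K) B φ))) -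
              (Complex.exp (-(eval (opB D K) B φ)) - 1 + eval (opB D K) B φ)) +
          bprod (L ^ k) (fun B' => expNegH Ht B' φ) (U \ B) *
              bprod (L ^ k) (fun B' => expNegH (-Ht) B' φ) (B \ U) *
            fluct D.𝒞 (fun ψ => ∑ Y ∈ ((polys (L ^ k) B).erase B).erase ∅,
              bprod (L ^ k) (fun B' => expNegH H B' ψ - 1) (B \ Y) * K Y ψ) φ)) -
        (∑ B ∈ blockPartIndex D U,
        ((bprod (L ^ k) (fun B' => expNegH Ht' B' φ) (U \ B) *
              bprod (L ^ k) (fun B' => expNegH (-Ht') B' φ) (B \ U) - 1) * blockTerm D K' B φ +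
          bprod (L ^ k) (fun B' => expNegH Ht' B' φ) (U \ B) *
              bprod (L ^ k) (fun B' => expNegH (-Ht') B' φ) (B \ U) *
            (fluctDefect D.𝒞 H' B φ +
              (expNegH (stepOpA (gradCov D.𝒞) H') B φ - 1) * (1 - Complex.exp (-(eval (opB D K') B φ))) -
              (Complex.exp (-(eval (opB D K') B φ)) - 1 + eval (opB D K') B φ)) +
          bprod (L ^ k) (fun B' => expNegH Ht' B' φ) (U \ B) *
              bprod (L ^ k) (fun B' => expNegH (-Ht') B' φ) (B \ U) *
            fluct D.𝒞 (fun ψ => ∑ Y ∈ ((polys (L ^ k) B).erase B).erase ∅,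
              bprod (L ^ k) (fun B' => expNegH H' B' ψ - 1) (B \ Y) * K' Y ψ) φ)))
      (((L ^ d : ℕ) : ℝ) * κ ^ (L ^ d) *
        (16 * Real.exp (3 / 8) * hamNorm (fieldWt h (L : ℝ) d k) ((L : ℝ) ^ k) (L ^ (d * k)) (Ht - Ht') *
            ((1 + 8 * pi2BoundConst d (((2 * R + 2 : ℕ) : ℝ) + ((d / 2 + 1 : ℕ) : ℝ))) * (C * A𝒫' * A⁻¹) +
              256 * Real.exp (1 / 4) * ((A𝒫' + 4) * b ^ 2 +
                2 * b * (pi2BoundConst d (((2 * R + 2 : ℕ) : ℝ) + ((d / 2 + 1 : ℕ) : ℝ)) * (C * A𝒫' * A⁻¹)) +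
                (pi2BoundConst d (((2 * R + 2 : ℕ) : ℝ) + ((d / 2 + 1 : ℕ) : ℝ)) * (C * A𝒫' * A⁻¹)) ^ 2)) +
          16 * Real.exp (3 / 8) * τ *
            ((1 + 8 * pi2BoundConst d (((2 * R + 2 : ℕ) : ℝ) + ((d / 2 + 1 : ℕ) : ℝ))) * (CΔ * A𝒫' * A⁻¹)) +
          (512 * Real.exp (1 / 4) * (A𝒫' + 4) * (b + b) *
              hamNorm (fieldWt h (L : ℝ) d k) ((L : ℝ) ^ k) (L ^ (d * k)) (H - H') +
            512 * Real.exp (1 / 4) *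
              (hamNorm (fieldWt h (L : ℝ) d k) ((L : ℝ) ^ k) (L ^ (d * k)) (H - H') *
                  (pi2BoundConst d (((2 * R + 2 : ℕ) : ℝ) + ((d / 2 + 1 : ℕ) : ℝ)) * (C * A𝒫' * A⁻¹)) +
                b * (pi2BoundConst d (((2 * R + 2 : ℕ) : ℝ) + ((d / 2 + 1 : ℕ) : ℝ)) * (CΔ * A𝒫' * A⁻¹))) +
            256 * Real.exp (1 / 4) *
              (pi2BoundConst d (((2 * R + 2 : ℕ) : ℝ) + ((d / 2 + 1 : ℕ) : ℝ)) * (C * A𝒫' * A⁻¹) +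
                pi2BoundConst d (((2 * R + 2 : ℕ) : ℝ) + ((d / 2 + 1 : ℕ) : ℝ)) * (CΔ * A𝒫' * A⁻¹)) *
              (pi2BoundConst d (((2 * R + 2 : ℕ) : ℝ) + ((d / 2 + 1 : ℕ) : ℝ)) * (CΔ * A𝒫' * A⁻¹)))) *
        (A * (abkmNormParams L N Mord R p r₀ h θbar A (schedDelta δ₀ δ₁ N) 𝒞).aFactor (k + 1) U)) := by
  set P := abkmNormParams L N Mord R p r₀ h θbar A (schedDelta δ₀ δ₁ N) 𝒞 with hP
  set W := abkmWeightData L N Mord R θbar (schedDelta δ₀ δ₁ N) 𝒞 with hW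
  have hL0 : (0 : ℝ) < L := by exact_mod_cast hLodd.pos
  have hA0 : 0 < A := by linarith
  have hsodd : Odd (L ^ k) := hLodd.pow
  have h𝔥 : 0 < fieldWt h (L : ℝ) d k := fieldWt_pos hh hL0 d k
  have hRk : (0 : ℝ) < (L : ℝ) ^ k := by positivity
  have hnn : ∀ G : RelevantHamiltonian ℂ d, 0 ≤ hamNorm (fieldWt h (L : ℝ) d k) ((L : ℝ) ^ k) (L ^ (d * k)) G :=
    fun G => hamNorm_nonneg h𝔥.le hRk.le _ _
  have h1 := tayNormLE_remainderOne_sub_abkm_of_stepKernelBounds hd hLodd hL hR2 hM hkN hp hpR hMord hr₀ hB hδ₀ hδ₁ hh hh0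
    hh2 hA𝒫 hA1 D hDs hDL hS hB₀ hc₀ hU hHt hHt' hτ hH hH' hb hC hCΔ hK hK' hΔ hKd hK'd hKloc hK'loc hv hκ hκ'
  by_cases hne : (blockPartIndex D U).Nonempty
  · obtain ⟨B, hB'⟩ := hne
    have hcl := (mem_filter.1 hB').2
    have hBb := (mem_filter.1 hB').1
    rw [hDs] at hBb
    obtain ⟨x, -, rfl⟩ := mem_blocks.1 hBb
    rw [hDs, hDL, closure_blockOf_mul hsodd hLodd x] at hcl
    have hcard1 : (blocks (L * L ^ k) U).card = 1 := by rw [← hcl, blocks_blockOf, card_singleton]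
    have hnb : numBlocks (P.L ^ (k + 1)) U = 1 := by
      show numBlocks (L ^ (k + 1)) U = 1
      rw [← card_blocks_eq_numBlocks, pow_succ', hcard1]
    have haF : A * P.aFactor (k + 1) U = 1 := by
      show A * (A ^ numBlocks (P.L ^ (k + 1)) U)⁻¹ = 1
      rw [hnb, pow_one, mul_inv_cancel₀ hA0.ne']
    have hMeq : M = L * L ^ k * L ^ (N - k - 1) := by
      rw [hM, ← pow_succ', ← pow_add]; congr 1; omega
    have hU' : IsPolymer (L * L ^ k) U := by rw [← pow_succ']; exact hU
    have hm0 : (blocks (L ^ k) U).card = L ^ d := by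
      rw [TorusPolymer.card_blocks_eq_mul hMeq hsodd hLodd hLodd.pow hU', hcard1, mul_one]
    rw [hm0] at h1
    rw [haF, mul_one]
    exact h1
  · rw [not_nonempty_iff_eq_empty] at hne
    intro φ
    have hF : (fun φ => (∑ B ∈ blockPartIndex D U,
        ((bprod (L ^ k) (fun B' => expNegH Ht B' φ) (U \ B) *
              bprod (L ^ k) (fun B' => expNegH (-Ht) B' φ) (B \ U) - 1) * blockTerm D K B φ +
          bprod (L ^ k) (fun B' => expNegH Ht B' φ) (U \ B) *
              bprod (L ^ k) (fun B' => expNegH (-Ht) B' φ) (B \ U) *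
            (fluctDefect D.𝒞 H B φ +
              (expNegH (stepOpA (gradCov D.𝒞) H) B φ - 1) * (1 - Complex.exp (-(eval (opB D K) B φ))) -
              (Complex.exp (-(eval (opB D K) B φ)) - 1 + eval (opB D K) B φ)) +
          bprod (L ^ k) (fun B' => expNegH Ht B' φ) (U \ B) *
              bprod (L ^ k) (fun B' => expNegH (-Ht) B' φ) (B \ U) *
            fluct D.𝒞 (fun ψ => ∑ Y ∈ ((polys (L ^ k) B).erase B).erase ∅,
              bprod (L ^ k) (fun B' => expNegH H B' ψ - 1) (B \ Y) * K Y ψ) φ)) -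
        (∑ B ∈ blockPartIndex D U,
        ((bprod (L ^ k) (fun B' => expNegH Ht' B' φ) (U \ B) *
              bprod (L ^ k) (fun B' => expNegH (-Ht') B' φ) (B \ U) - 1) * blockTerm D K' B φ +
          bprod (L ^ k) (fun B' => expNegH Ht' B' φ) (U \ B) *
              bprod (L ^ k) (fun B' => expNegH (-Ht') B' φ) (B \ U) *
            (fluctDefect D.𝒞 H' B φ +
              (expNegH (stepOpA (gradCov D.𝒞) H') B φ - 1) * (1 - Complex.exp (-(eval (opB D K') B φ))) -
              (Complex.exp (-(eval (opB D K') B φ)) - 1 + eval (opB D K') B φ)) +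
          bprod (L ^ k) (fun B' => expNegH Ht' B' φ) (U \ B) *
              bprod (L ^ k) (fun B' => expNegH (-Ht') B' φ) (B \ U) *
            fluct D.𝒞 (fun ψ => ∑ Y ∈ ((polys (L ^ k) B).erase B).erase ∅,
              bprod (L ^ k) (fun B' => expNegH H' B' ψ - 1) (B \ Y) * K' Y ψ) φ))) = fun _ => (0 : ℂ) := by
      funext ψ; rw [hne, sum_empty, sum_empty, sub_zero]
    rw [hF, tayNorm_const, norm_zero]
    have hτ0 : 0 ≤ τ := (hnn Ht).trans hHt
    have hb0 : 0 ≤ b := (hnn H).trans hH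
    have hκ0 : 0 ≤ κ := by
      have : 0 ≤ 16 * Real.exp (3 / 8) * τ := by positivity
      linarith [hκ', Real.exp_pos (1 / 4)]
    have hC87 : 0 ≤ pi2BoundConst d (((2 * R + 2 : ℕ) : ℝ) + ((d / 2 + 1 : ℕ) : ℝ)) := pi2BoundConst_nonneg d (by positivity)
    have hAinv : 0 ≤ A⁻¹ := inv_nonneg.2 hA0.le
    have h1n := hnn (Ht - Ht')
    have h2n := hnn (H - H')
    have haF0 : 0 ≤ P.aFactor (k + 1) U := (WeakNormLE.aFactor_pos hA0 (k + 1) U).le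
    have hw0 := (W.weight_pos (k + 1) U φ).le
    have hBIG : 0 ≤ (16 * Real.exp (3 / 8) * hamNorm (fieldWt h (L : ℝ) d k) ((L : ℝ) ^ k) (L ^ (d * k)) (Ht - Ht') *
            ((1 + 8 * pi2BoundConst d (((2 * R + 2 : ℕ) : ℝ) + ((d / 2 + 1 : ℕ) : ℝ))) * (C * A𝒫' * A⁻¹) +
              256 * Real.exp (1 / 4) * ((A𝒫' + 4) * b ^ 2 +
                2 * b * (pi2BoundConst d (((2 * R + 2 : ℕ) : ℝ) + ((d / 2 + 1 : ℕ) : ℝ)) * (C * A𝒫' * A⁻¹)) +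
                (pi2BoundConst d (((2 * R + 2 : ℕ) : ℝ) + ((d / 2 + 1 : ℕ) : ℝ)) * (C * A𝒫' * A⁻¹)) ^ 2)) +
          16 * Real.exp (3 / 8) * τ *
            ((1 + 8 * pi2BoundConst d (((2 * R + 2 : ℕ) : ℝ) + ((d / 2 + 1 : ℕ) : ℝ))) * (CΔ * A𝒫' * A⁻¹)) +
          (512 * Real.exp (1 / 4) * (A𝒫' + 4) * (b + b) *
              hamNorm (fieldWt h (L : ℝ) d k) ((L : ℝ) ^ k) (L ^ (d * k)) (H - H') +
            512 * Real.exp (1 / 4) *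
              (hamNorm (fieldWt h (L : ℝ) d k) ((L : ℝ) ^ k) (L ^ (d * k)) (H - H') *
                  (pi2BoundConst d (((2 * R + 2 : ℕ) : ℝ) + ((d / 2 + 1 : ℕ) : ℝ)) * (C * A𝒫' * A⁻¹)) +
                b * (pi2BoundConst d (((2 * R + 2 : ℕ) : ℝ) + ((d / 2 + 1 : ℕ) : ℝ)) * (CΔ * A𝒫' * A⁻¹))) +
            256 * Real.exp (1 / 4) *
              (pi2BoundConst d (((2 * R + 2 : ℕ) : ℝ) + ((d / 2 + 1 : ℕ) : ℝ)) * (C * A𝒫' * A⁻¹) +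
                pi2BoundConst d (((2 * R + 2 : ℕ) : ℝ) + ((d / 2 + 1 : ℕ) : ℝ)) * (CΔ * A𝒫' * A⁻¹)) *
              (pi2BoundConst d (((2 * R + 2 : ℕ) : ℝ) + ((d / 2 + 1 : ℕ) : ℝ)) * (CΔ * A𝒫' * A⁻¹)))) := by positivity
    have hLd : (0 : ℝ) ≤ ((L ^ d : ℕ) : ℝ) := Nat.cast_nonneg _
    exact mul_nonneg (mul_nonneg (mul_nonneg (mul_nonneg hLd (pow_nonneg hκ0 _)) hBIG) (mul_nonneg hA0.le haF0)) hw0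

end Literature.MathematicalPhysics.StatisticalMechanics.GradientRG

end
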